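import Mathlib

/-!
# T5EmptyInterior — thin sets of a chart have empty interior

Kernel support (blind lane, Mathlib only) for route/T5-N1-hodge-p6.md §H6 / §H9, the two clauses
listed as prose at v6.1: «a curve in A_a × A_b has empty interior» (the consequence of H6 used in
T5LocalImage / T5SurfaceImage: the image of a neighbourhood under the chart map
`F_{ab} = (z_a ∘ f̃_a, z_b ∘ f̃_b)` lies in no subset of `ℂ²` with empty interior) and «a holomorphic
section … is zero iff it vanishes on a non-empty open set» (the identity theorem, in the form
«the zero set of a non-zero analytic function has empty interior»).

Two kinds of thin sets are treated, both at the chart level (a finite-dimensional real normed space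
`E` with an add-Haar measure, e.g. `ℂ² = ℂ × ℂ` with Lebesgue measure):

* the zero set of an analytic function that does not vanish identically on a connected open set —
  `interior_zeroSet_eq_empty` (from Mathlib's identity theorem
  `AnalyticOnNhd.eqOn_zero_of_preconnected_of_eventuallyEq_zero`);
* the image of a differentiable map from a space of SMALLER dimension —
  `addHaar_image_eq_zero_of_finrank_lt` (Lebesgue-null: Mathlib's Sard-type lemma
  `addHaar_image_eq_zero_of_det_fderivWithin_eq_zero`, applied to the composite with a surjective
  linear map `E → F`) and `interior_image_eq_empty_of_finrank_lt`; specialised to a holomorphic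
  curve `γ : ℂ → ℂ × ℂ` in `interior_image_curve_eq_empty` (dimension 2 < 4 over `ℝ`).

Nothing geometric is constructed: the abelian varieties `A_a`, `A_b`, the map `f_{ab}` and the
passage chart → manifold stay prose, as in §H8–H10 of the memo.
-/

namespace Summit.Ventures.HodgeRepro2.T5EmptyInterior

open Set Module MeasureTheory Measure

section ZeroSet

variable {𝕜 : Type*} [NontriviallyNormedField 𝕜] {E : Type*} [NormedAddCommGroup E]
  [NormedSpace 𝕜 E] {F : Type*} [NormedAddCommGroup F] [NormedSpace 𝕜 F]

/-- If an analytic function on a connected open set vanishes on a neighbourhood of one point of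
the set, it vanishes on the whole set (Mathlib's identity theorem, restated with the interior of the
zero set). -/
theorem eqOn_zero_of_mem_interior_zeroSet {f : E → F} {U : Set E} (hf : AnalyticOnNhd 𝕜 f U)
    (hU : IsPreconnected U) {z : E} (hz : z ∈ U) (hzi : z ∈ interior {x | f x = 0}) :
    EqOn f 0 U := by
  refine hf.eqOn_zero_of_preconnected_of_eventuallyEq_zero hU hz ?_
  filter_upwards [mem_interior_iff_mem_nhds.1 hzi] with x hx
  exact hx

/-- The zero set of an analytic function on a connected open set `U` which is not identically zero
on `U` has empty interior inside `U`: the chart form of «a holomorphic section of a line bundle on a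
connected manifold is zero iff it vanishes on a non-empty open set». -/
theorem interior_zeroSet_eq_empty {f : E → F} {U : Set E} (hf : AnalyticOnNhd 𝕜 f U)
    (hU : IsPreconnected U) (hne : ∃ z ∈ U, f z ≠ 0) :
    interior {x | x ∈ U ∧ f x = 0} = ∅ := by
  rw [eq_empty_iff_forall_notMem]
  intro z hz
  have hzU : z ∈ U := (interior_subset hz).1
  have hzi : z ∈ interior {x | f x = 0} :=
    interior_mono (fun x (hx : x ∈ U ∧ f x = 0) => hx.2) hz
  obtain ⟨w, hwU, hw⟩ := hne
  exact hw (eqOn_zero_of_mem_interior_zeroSet hf hU hzU hzi hwU)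

/-- The same for the zero set of `f` restricted to an OPEN connected set: `interior (U ∩ {f = 0})`
is empty, so no non-empty open subset of `U` lies in the zero set. -/
theorem not_subset_zeroSet_of_isOpen {f : E → F} {U : Set E} (hf : AnalyticOnNhd 𝕜 f U)
    (hU : IsPreconnected U) (hne : ∃ z ∈ U, f z ≠ 0) {V : Set E} (hV : IsOpen V)
    (hVU : V ⊆ U) (hVne : V.Nonempty) : ¬ ∀ x ∈ V, f x = 0 := by
  intro hzero
  have hsub : V ⊆ interior {x | x ∈ U ∧ f x = 0} :=
    interior_maximal (fun x hx => ⟨hVU hx, hzero x hx⟩) hV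
  rw [interior_zeroSet_eq_empty hf hU hne] at hsub
  exact hVne.ne_empty (subset_empty_iff.1 hsub)

end ZeroSet

section LowerDimension

variable {E : Type*} [NormedAddCommGroup E] [NormedSpace ℝ E] [FiniteDimensional ℝ E]
  {F : Type*} [NormedAddCommGroup F] [NormedSpace ℝ F] [FiniteDimensional ℝ F]

/-- A linear endomorphism of a finite-dimensional space whose range is not everything has
determinant zero. -/
theorem det_eq_zero_of_range_ne_top (A : E →ₗ[ℝ] E) (hA : LinearMap.range A ≠ ⊤) :
    A.det = 0 := by
  rw [LinearMap.det_eq_zero_iff_ker_ne_bot]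
  intro hker
  exact hA ((LinearMap.isUnit_iff_range_eq_top A).1 ((LinearMap.isUnit_iff_ker_eq_bot A).2 hker))

/-- A linear endomorphism of `E` that factors through a space `F` of smaller dimension has
determinant zero. -/
theorem det_comp_eq_zero_of_finrank_lt (g : F →ₗ[ℝ] E) (p : E →ₗ[ℝ] F)
    (h : finrank ℝ F < finrank ℝ E) : (g ∘ₗ p).det = 0 := by
  refine det_eq_zero_of_range_ne_top _ fun htop => ?_
  have h1 : finrank ℝ (LinearMap.range (g ∘ₗ p)) ≤ finrank ℝ (LinearMap.range g) :=
    Submodule.finrank_mono (LinearMap.range_comp_le_range p g)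
  have h2 : finrank ℝ (LinearMap.range g) ≤ finrank ℝ F := LinearMap.finrank_range_le g
  rw [htop, finrank_top] at h1
  exact absurd (lt_of_le_of_lt (h1.trans h2) h) (lt_irrefl _)

/-- A surjective continuous linear map `E → F` exists as soon as `finrank F ≤ finrank E`
(coordinates in bases, then the restriction `Fin n → ℝ` to `Fin m → ℝ`). -/
theorem exists_surjective_continuousLinearMap (h : finrank ℝ F ≤ finrank ℝ E) :
    ∃ p : E →L[ℝ] F, Function.Surjective p := by
  let bE := Module.finBasis ℝ E
  let bF := Module.finBasis ℝ F
  let r : (Fin (finrank ℝ E) → ℝ) →ₗ[ℝ] (Fin (finrank ℝ F) → ℝ) :=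
    LinearMap.funLeft ℝ ℝ (Fin.castLE h)
  have hr : Function.Surjective r :=
    LinearMap.funLeft_surjective_of_injective ℝ ℝ _ (Fin.castLE_injective h)
  let p : E →ₗ[ℝ] F := bF.equivFun.symm.toLinearMap ∘ₗ r ∘ₗ bE.equivFun.toLinearMap
  refine ⟨LinearMap.toContinuousLinearMap p, ?_⟩
  show Function.Surjective p
  simp only [p, LinearMap.coe_comp, LinearEquiv.coe_coe]
  exact bF.equivFun.symm.surjective.comp (hr.comp bE.equivFun.surjective)

variable [MeasurableSpace E] [BorelSpace E] (μ : Measure E) [μ.IsAddHaarMeasure]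

/-- Sard in the lower-dimensional case: the image of a set `t ⊆ F` under a map `g : F → E`
differentiable on `t` is null for every add-Haar measure of `E` when `finrank F < finrank E`.
(Mathlib's `addHaar_image_eq_zero_of_det_fderivWithin_eq_zero` applied to `g ∘ p` for a surjective
linear `p : E → F`: its derivative factors through `F`, so its determinant vanishes.) -/
theorem addHaar_image_eq_zero_of_finrank_lt {g : F → E} {t : Set F}
    (hg : DifferentiableOn ℝ g t) (h : finrank ℝ F < finrank ℝ E) : μ (g '' t) = 0 := by
  obtain ⟨p, hp⟩ := exists_surjective_continuousLinearMap h.le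
  have himage : g '' t = (g ∘ p) '' (p ⁻¹' t) := by
    rw [image_comp, image_preimage_eq t hp]
  rw [himage]
  refine addHaar_image_eq_zero_of_det_fderivWithin_eq_zero μ
    (f' := fun x => (fderivWithin ℝ g t (p x)).comp p) (fun x hx => ?_) (fun x _ => ?_)
  · exact (hg (p x) hx).hasFDerivWithinAt.comp x p.hasFDerivWithinAt (mapsTo_preimage p t)
  · exact det_comp_eq_zero_of_finrank_lt (fderivWithin ℝ g t (p x) : F →ₗ[ℝ] E) (p : E →ₗ[ℝ] F) h

include μ in
/-- The image of a lower-dimensional differentiable map has empty interior (null for an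
open-positive measure; the add-Haar measure `μ` is a witness and does not enter the
conclusion). -/
theorem interior_image_eq_empty_of_finrank_lt {g : F → E} {t : Set F}
    (hg : DifferentiableOn ℝ g t) (h : finrank ℝ F < finrank ℝ E) : interior (g '' t) = ∅ :=
  Measure.interior_eq_empty_of_null (addHaar_image_eq_zero_of_finrank_lt μ hg h)

include μ in
/-- No neighbourhood of a point of `E` is contained in the image of a lower-dimensional
differentiable map: the form in which «a curve has empty interior» enters T5LocalImage. -/
theorem not_subset_image_of_finrank_lt {g : F → E} {t : Set F} (hg : DifferentiableOn ℝ g t)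
    (h : finrank ℝ F < finrank ℝ E) {x : E} {N : Set E} (hN : N ∈ nhds x) : ¬ N ⊆ g '' t := by
  intro hsub
  have hx : x ∈ interior (g '' t) := interior_mono hsub (mem_interior_iff_mem_nhds.2 hN)
  rw [interior_image_eq_empty_of_finrank_lt μ hg h] at hx
  exact hx

end LowerDimension

section Curve

/-- The real dimension of `ℂ × ℂ` is `4`. -/
theorem finrank_real_complex_prod : finrank ℝ (ℂ × ℂ) = 4 := by
  rw [Module.finrank_prod, Complex.finrank_real_complex]

/-- A holomorphic (indeed any differentiable) curve `γ : ℂ → ℂ × ℂ`, restricted to any set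
`t ⊆ ℂ`, has an image with empty interior in `ℂ²` (real dimension `2 < 4`): «a curve in
`A_a × A_b` has empty interior», at the chart level. -/
theorem interior_image_curve_eq_empty {γ : ℂ → ℂ × ℂ} {t : Set ℂ}
    (hγ : DifferentiableOn ℂ γ t) : interior (γ '' t) = ∅ := by
  have h : finrank ℝ ℂ < finrank ℝ (ℂ × ℂ) := by
    rw [finrank_real_complex_prod, Complex.finrank_real_complex]
    norm_num
  exact interior_image_eq_empty_of_finrank_lt (Module.finBasis ℝ (ℂ × ℂ)).addHaar
    (hγ.restrictScalars ℝ) h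

/-- The image of a holomorphic curve in `ℂ²` is null for every add-Haar measure of `ℂ²`, in
particular for the product Lebesgue measure `volume`. -/
theorem addHaar_image_curve_eq_zero (μ : Measure (ℂ × ℂ)) [μ.IsAddHaarMeasure] {γ : ℂ → ℂ × ℂ}
    {t : Set ℂ} (hγ : DifferentiableOn ℂ γ t) : μ (γ '' t) = 0 := by
  have h : finrank ℝ ℂ < finrank ℝ (ℂ × ℂ) := by
    rw [finrank_real_complex_prod, Complex.finrank_real_complex]
    norm_num
  exact addHaar_image_eq_zero_of_finrank_lt μ (hγ.restrictScalars ℝ) h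

/-- The Lebesgue measure of `ℂ²` (the product of the Lebesgue measures of the two factors) is an
add-Haar measure. -/
theorem isAddHaarMeasure_volume_complex_prod : (volume : Measure (ℂ × ℂ)).IsAddHaarMeasure :=
  Measure.prod.instIsAddHaarMeasure volume volume

/-- The image of a holomorphic curve in `ℂ²` is Lebesgue-null. -/
theorem volume_image_curve_eq_zero {γ : ℂ → ℂ × ℂ} {t : Set ℂ} (hγ : DifferentiableOn ℂ γ t) :
    volume (γ '' t) = 0 :=
  haveI := isAddHaarMeasure_volume_complex_prod
  addHaar_image_curve_eq_zero volume hγ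

end Curve

end Summit.Ventures.HodgeRepro2.T5EmptyInterior
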